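import Literature.Computability.AlgebraicComplexity.LocalStrongUSP
import Literature.Computability.AlgebraicComplexity.StrongUSPCapacityLocal
import Literature.Barriers.MatrixMultiplication.TricoloredSumFreeBarrierEffective
import HarnessLib

/-!
# The strong USP conjecture (Cohn–Kleinberg–Szegedy–Umans 2005, Conj. 3.4) is false: the strong USP
# capacity is at most `3/2^{(2+3c₃)/3} ≈ 1.791 < 3/2^{2/3} ≈ 1.890` (Blasiak–Church–Cohn–Grochow–Naslund–Sawin–Umans 2017, via Thm. A/B) — proved

Topic `Literature/Computability/AlgebraicComplexity` (group-theoretic matrix multiplication),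
namespace `Literature.Computability.AlgebraicComplexity`; companion of `StrongUSP.lean`
(`IsStrongUSP`, `IsLocalStrongUSP`), `LocalStrongUSP.lean` (CKSU Thm. 33, PROVED:
`CohnKleinbergSzegedyUmans2005_thm33_holds`), `StrongUSPCapacityLocal.lean` (CKSU Prop. 6.3,
PROVED: `exists_isLocalStrongUSP_card_ge_pow_of_strongUSP`), `USPCapacityUpperBound.lean` (CKSU
Lemma 3.2: capacity `≤ 3/2^{2/3}`), `StrongUSPTriangle.lean` (CKSU Prop. 3.8: capacity `≥ 2^{2/3}`)
and of the barrier entry `Literature/Barriers/MatrixMultiplication/TricoloredSumFreeBarrier.lean`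
(BCCGNSU 2017 Thms. A/A′/B, PROVED; effective form `BCCGNSU2017_thmB_elementary` in
`TricoloredSumFreeBarrierEffective.lean`).

## Sources (held texts read this session)

* H. Cohn, R. Kleinberg, B. Szegedy, C. Umans, *Group-theoretic algorithms for matrix
  multiplication*, FOCS 2005 = arXiv:math/0511460 [CohnKleinbergSzegedyUmans2005], held text
  `paper:arxiv-math_0511460`: §3 p. 5 L150–156 "We define the strong USP capacity to be the largest
  constant `C` such that there exist strong USPs of size `(C−o(1))^k` and width `k` for infinitely
  many values of `k`."; p. 6 L46–49 "**Conjecture 14** [= FOCS Conj. 3.4]. The strong USP capacity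
  equals `3/2^{2/3}`. This conjecture would imply that `ω=2`"; p. 6 L128–145 "**Corollary 16**
  [= FOCS Cor. 3.6]. … if the strong USP capacity is `C`, then `ω ≤ 3(log m − log C)/log(m−1)`. …
  If Conjecture 14 holds, then Corollary 16 yields `ω=2` upon taking `m=3`."; §6.1 p. 10 (Thm. 33,
  Prop. 34 = FOCS Prop. 6.3).
* J. Blasiak, T. Church, H. Cohn, J. A. Grochow, E. Naslund, W. F. Sawin, C. Umans, *On cap sets and
  the group-theoretic approach to matrix multiplication*, Discrete Analysis 2017:3 =
  arXiv:1605.06702 [BlasiakChurchCohnGrochowNaslundSawinUmans2017], held text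
  `paper:arxiv-1605.06702`: §1 p. 3 L19–22 "Alon et al. also showed that a tricolored version of the
  cap set bounds would disprove the 'strong Uniquely Solvable Puzzle (USP)' conjecture of Cohn,
  Kleinberg, Szegedy, and Umans"; p. 3 L75–76 "In particular, Theorem A disproves the strong USP
  conjecture via [ASU]"; §3 p. 6 L8–15 "Both the strong USP conjecture [CKSU] and the 'two
  families' conjecture [CKSU] would, if true, yield STPP constructions that meet the packing bound
  and moreover prove `ω = 2`. However, the STPP constructions produced by the strong USP conjecture
  have underlying group `H = 𝔽₃ⁿ` … Thus although Theorem B disproves the strong USP conjecture,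
  it addresses only very special cases of the two families conjecture."
* M. Anderson, V. Le, *Efficiently-verifiable strong uniquely solvable puzzles and matrix
  multiplication*, arXiv:2307.06463 [AndersonLe2023], held text p. 5 L44–46 "Cohn et al. also
  shows that if the SUSP capacity is `C_max = 3/2^{2/3}`, it immediately follows that `ω = 2`. …
  subsequent work has shown that the SUSP capacity is strictly less than `C_max`", and p. 3
  L33–37 "there exists an `ǫ > 0` such that this framework … cannot achieve `ω = 2 + ǫ`. … the
  authors are unaware of a concrete value known for this `ǫ`."

The status line of `Literature/StrongHypotheses/MatrixMultiplication.lean` ("REFUTED — … Not in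
tree as a closed decl") and the docstrings of `USPCapacityUpperBound.lean` /
`USPCapacityLowerBound.lean` ("Conjecture 3.4 / 14 … open", resp. "refuted in its `ω = 2`
consequence only") predate this file: the conjecture ITSELF (a statement about sizes of strong USPs,
not about `ω`) is refuted here, with an explicit constant.

## What is proved (no definitions, no named facts; all sorry-free)

Write `c₃ = foxLovaszExponent 3 = −log J(3)/log 3 ≈ 0.0775` (the Kleinberg–Sawin–Speyer / Fox–Lovász
exponent, `Literature/Combinatorics/Additive/TightTriangleRemoval.lean`; `J = bccgnsuJ`, BCCGNSU
(4.10)) and `B₃ := 3/2^{(2+3c₃)/3} ≈ 1.7910`; the conjectured capacity is `3/2^{2/3} ≈ 1.8899` and the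
best known lower bound is `2^{2/3} ≈ 1.5874` (CKSU Prop. 3.8, the tree's `exists_isStrongUSP_card_ge_pow`).

* `card_uspA`, `card_uspB`, `card_uspC`, `card_uspA_mul_card_uspB_mul_card_uspC` — the sizes of
  the CKSU Thm. 33 triples: `|A_u| |B_u| |C_u| = (ℓ−1)^k` for EVERY row `u` of width `k` (each
  coordinate contributes `ℓ − 1` to exactly one of the three sets).
* `IsLocalStrongUSP.card_mul_rpow_le`, **`IsLocalStrongUSP.card_le_pow`** — every local strong USP
  of width `k` has at most `B₃^k` rows, for EVERY `k` (no `o(1)`): Thm. 33 at `ℓ = 3` makes it an STPP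
  construction of `s` triples with `|A||B||C| = 2^k` in `𝔽₃ᵏ`, and the effective Thm. B for
  elementary abelian `3`-groups (`BCCGNSU2017_thmB_elementary`: `Σᵢ(|Aᵢ||Bᵢ||Cᵢ|)^{(2+3c₃)/3} ≤ |H|`)
  reads `s · 2^{k(2+3c₃)/3} ≤ 3^k`. Closed form `IsLocalStrongUSP.card_le_pow_delta`: at most
  `(3/2^{(2+3δ/log 3)/3})^k ≈ 1.8235^k` rows, `δ = bccgnsuDelta = log((2/3)2^{2/3})` (Thm. A′).
* **`IsStrongUSP.eventually_card_lt_pow_of_lt`** — "the strong USP capacity is at most `B₃`", in the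
  `∀ C`-unfolding of CKSU's definition used throughout the tree (`IsStrongUSP.eventually_card_lt_pow`,
  `exists_isStrongUSP_card_ge_pow`): for every `C > B₃` there is `K` such that every strong USP of
  every width `k ≥ K` has fewer than `C^k` rows (transfer from local strong USPs by CKSU Prop. 6.3,
  `exists_isLocalStrongUSP_card_ge_pow_of_strongUSP`).
* **`strongUSPCapacity_lt`** — there is `C < 3/2^{2/3}` beyond which, for all large widths, no strong
  USP has `C^k` rows; and **`CKSU2005_strongUSPConjecture_false`** — the negation of Conj. 3.4 / 14
  in the same unfolding ("for every `C < 3/2^{2/3}` there are strong USPs of width `k` and size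
  `≥ C^k` for infinitely many `k`" is FALSE).

## Wording risks

* CKSU's capacity is "the largest `C` such that there exist strong USPs of size `(C−o(1))^k` and
  width `k` for infinitely many `k`"; with Lemma 3.2 (capacity `≤ 3/2^{2/3}`, the tree's
  `IsStrongUSP.eventually_card_lt_pow`) Conj. 3.4 "equals `3/2^{2/3}`" is equivalent to "`≥`", i.e.
  to the `∀ C < 3/2^{2/3}` supply statement negated in `CKSU2005_strongUSPConjecture_false` (the
  `(C − o(1))^k` of print and the `C'^k, C' < C` of the unfolding define the same supremum).
* The printed refutation (BCCGNSU §1, §3) is qualitative and goes "via [ASU]" (Alon–Shpilka–Umans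
  2013 [AlonShpilkaUmans2013]: tricolored cap-set bounds ⇒ ¬ strong USP conjecture); the route here
  is BCCGNSU's own §3 sentence (strong USP ⇒ STPP in `𝔽₃ⁿ` ⇒ Thm. B), through CKSU Thm. 33 /
  Prop. 6.3, and the constant `B₃` is the tree's (Anderson–Le 2023: "the authors are unaware of a
  concrete value"). It is NOT claimed to be optimal.

WHAT THIS IS NOT: no statement about `ω` (the `ω`-side barrier is `BCCGNSU2017_thmB_elementary` /
`BlasiakChurchCohnGrochowNaslundSawinUmans2017_B_holds`); nothing about (non-strong) USPs, whose
capacity IS `3/2^{2/3}` (CKSU Thm. 3.3, Coppersmith–Winograd); no lower bound on the strong USP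
capacity beyond the tree's `2^{2/3}`.
-/

noncomputable section

open scoped BigOperators

namespace Literature.Computability.AlgebraicComplexity

open Finset Literature.Combinatorics.Additive Literature.Barriers.MatrixMultiplication

/-! ## Sizes of the Thm. 33 triples -/

section Card

variable (ℓ : ℕ) [NeZero ℓ] {k L : ℕ}

/-- `#{x ∈ Cyc_ℓ^k : (x_j ≠ 0 ⇔ P j) for all j} = ∏ⱼ (ℓ − 1 if P j, else 1)`: the set is the box
`∏ⱼ (Cyc_ℓ ∖ {0} if P j, else {0})`. [folklore] -/
private theorem card_eq_prod_of_support_iff (P : Fin k → Prop) [DecidablePred P]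
    (S : Finset (Fin k → ZMod ℓ)) (hS : ∀ x, x ∈ S ↔ ∀ j, x j ≠ 0 ↔ P j) :
    S.card = ∏ j, (if P j then ℓ - 1 else 1) := by
  classical
  have hSeq : S = Fintype.piFinset fun j =>
      if P j then (univ : Finset (ZMod ℓ)).erase 0 else {0} := by
    ext x
    rw [hS, Fintype.mem_piFinset]
    refine forall_congr' fun j => ?_
    split_ifs with hj
    · simp [hj]
    · simp [hj]
  rw [hSeq, Fintype.card_piFinset]
  refine Finset.prod_congr rfl fun j _ => ?_
  split_ifs with hj
  · rw [Finset.card_erase_of_mem (Finset.mem_univ _), Finset.card_univ, ZMod.card]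
  · rw [Finset.card_singleton]

/-- `|A_u| = (ℓ−1)^{#{j : u_j = 1}}`, written as a product over the coordinates.
[cite: CohnKleinbergSzegedyUmans2005, Thm. 33 (p. 10)] -/
theorem card_uspA (row : Fin L → Fin k → Fin 3) (a : Fin L) :
    (uspA ℓ row a).card = ∏ j, (if row a j = 0 then ℓ - 1 else 1) :=
  card_eq_prod_of_support_iff ℓ (fun j => row a j = 0) _ (mem_uspA_iff ℓ row a)

/-- `|B_u| = (ℓ−1)^{#{j : u_j = 2}}`. [cite: CohnKleinbergSzegedyUmans2005, Thm. 33 (p. 10)] -/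
theorem card_uspB (row : Fin L → Fin k → Fin 3) (a : Fin L) :
    (uspB ℓ row a).card = ∏ j, (if row a j = 1 then ℓ - 1 else 1) :=
  card_eq_prod_of_support_iff ℓ (fun j => row a j = 1) _ (mem_uspB_iff ℓ row a)

/-- `|C_u| = (ℓ−1)^{#{j : u_j = 3}}`. [cite: CohnKleinbergSzegedyUmans2005, Thm. 33 (p. 10)] -/
theorem card_uspC (row : Fin L → Fin k → Fin 3) (a : Fin L) :
    (uspC ℓ row a).card = ∏ j, (if row a j = 2 then ℓ - 1 else 1) :=
  card_eq_prod_of_support_iff ℓ (fun j => row a j = 2) _ (mem_uspC_iff ℓ row a)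

/-- **`|A_u| |B_u| |C_u| = (ℓ−1)^k` for every row `u` of width `k`**: each coordinate `j` carries
exactly one of the three symbols, so it contributes the factor `ℓ − 1` to exactly one of
`|A_u|, |B_u|, |C_u|` (the count behind CKSU Cor. 3.6: `|U|` triples of "volume" `(m−1)^k` in
`Cyc_m^k`). [cite: CohnKleinbergSzegedyUmans2005, Thm. 33 and Cor. 16 (pp. 6, 10)] -/
theorem card_uspA_mul_card_uspB_mul_card_uspC (row : Fin L → Fin k → Fin 3) (a : Fin L) :
    (uspA ℓ row a).card * (uspB ℓ row a).card * (uspC ℓ row a).card = (ℓ - 1) ^ k := by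
  rw [card_uspA, card_uspB, card_uspC, ← Finset.prod_mul_distrib, ← Finset.prod_mul_distrib]
  refine (Finset.prod_congr rfl fun j _ => ?_).trans
    (by rw [Finset.prod_const, Finset.card_univ, Fintype.card_fin])
  generalize row a j = c
  fin_cases c <;> simp

end Card

/-! ## Local strong USPs have at most `(3/2^{(2+3c₃)/3})^k` rows -/

/-- **Thm. 33 at `ℓ = 3` fed into the effective Thm. B for `𝔽₃ᵏ`**: a local strong USP with `s`
rows of width `k` gives an STPP construction of `s` triples with `|A||B||C| = 2^k` in `𝔽₃ᵏ`
(`CohnKleinbergSzegedyUmans2005_thm33_holds`), whence `s · (2^k)^{(2+3c₃)/3} ≤ 3^k`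
(`BCCGNSU2017_thmB_elementary` at `p = 3`). [cite: BlasiakChurchCohnGrochowNaslundSawinUmans2017, §3 (p. 6, "the STPP constructions produced by the strong USP conjecture have underlying group `H = 𝔽₃ⁿ` … Theorem B disproves the strong USP conjecture")] [cite: CohnKleinbergSzegedyUmans2005, Thm. 33 (p. 10)] -/
theorem IsLocalStrongUSP.card_mul_rpow_le {s k : ℕ} {row : Fin s → Fin k → Fin 3}
    (h : IsLocalStrongUSP row) :
    (s : ℝ) * ((2 : ℝ) ^ k) ^ ((2 + 3 * foxLovaszExponent 3) / 3) ≤ (3 : ℝ) ^ k := by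
  have hstpp : IsSTPP (uspA 3 row) (uspB 3 row) (uspC 3 row) :=
    CohnKleinbergSzegedyUmans2005_thm33_holds 3 k s row h
  have h3 : ((3 : ℕ) : ZMod 3) = 0 := ZMod.natCast_self 3
  have hH : ∀ x : Fin k → ZMod 3, 3 • x = 0 := fun x => by
    funext j
    show 3 • x j = 0
    rw [nsmul_eq_mul, h3, zero_mul]
  have hB := BCCGNSU2017_thmB_elementary Nat.prime_three (Fin k → ZMod 3) hH s (uspA 3 row)
    (uspB 3 row) (uspC 3 row) hstpp
  have hsummand : ∀ i : Fin s,
      (((uspA 3 row i).card * (uspB 3 row i).card * (uspC 3 row i).card : ℕ) : ℝ) =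
        (2 : ℝ) ^ k := by
    intro i
    rw [card_uspA_mul_card_uspB_mul_card_uspC]
    push_cast
    norm_num
  simp_rw [hsummand] at hB
  rw [Finset.sum_const, Finset.card_univ, Fintype.card_fin, nsmul_eq_mul] at hB
  have hcard : (Fintype.card (Fin k → ZMod 3) : ℝ) = (3 : ℝ) ^ k := by
    rw [Fintype.card_fun, ZMod.card, Fintype.card_fin]
    push_cast
    ring
  rwa [hcard] at hB

/-- **Every local strong USP of width `k` has at most `(3/2^{(2+3c₃)/3})^k ≈ 1.791^k` rows** (all `k`;
`c₃ = foxLovaszExponent 3`). The conjectured growth rate of STRONG USPs was `3/2^{2/3} ≈ 1.890`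
(CKSU Conj. 3.4), and "the strong USP capacity is achieved by local strong USPs" (CKSU Prop. 6.3).
[cite: BlasiakChurchCohnGrochowNaslundSawinUmans2017, §1 (p. 3, "Theorem A disproves the strong USP conjecture via [ASU]") and §3 (p. 6)] [cite: CohnKleinbergSzegedyUmans2005, Thm. 33 and Prop. 34 (p. 10)] -/
theorem IsLocalStrongUSP.card_le_pow {s k : ℕ} {row : Fin s → Fin k → Fin 3}
    (h : IsLocalStrongUSP row) :
    (s : ℝ) ≤ (3 / (2 : ℝ) ^ ((2 + 3 * foxLovaszExponent 3) / 3)) ^ k := by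
  set e : ℝ := (2 + 3 * foxLovaszExponent 3) / 3 with he
  have h2e : 0 < (2 : ℝ) ^ e := Real.rpow_pos_of_pos two_pos e
  have hmain := h.card_mul_rpow_le
  have hswap : ((2 : ℝ) ^ k) ^ e = ((2 : ℝ) ^ e) ^ k := by
    rw [← Real.rpow_natCast ((2 : ℝ) ^ e) k, ← Real.rpow_mul two_pos.le, mul_comm,
      Real.rpow_mul two_pos.le, Real.rpow_natCast]
  rw [hswap] at hmain
  rw [div_pow, le_div_iff₀ (pow_pos h2e k)]
  exact hmain

/-- Closed form: every local strong USP of width `k` has at most `(3/2^{(2+3δ/log 3)/3})^k ≈ 1.8235^k`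
rows, `δ = bccgnsuDelta = log((2/3)·2^{2/3}) = 0.05663…` the constant of BCCGNSU Thm. A′ (since
`c₃ ≥ δ/log 3`, `bccgnsuDelta_div_log_le_foxLovaszExponent`).
[cite: BlasiakChurchCohnGrochowNaslundSawinUmans2017, Thm. A′ and §3 (p. 6)] -/
theorem IsLocalStrongUSP.card_le_pow_delta {s k : ℕ} {row : Fin s → Fin k → Fin 3}
    (h : IsLocalStrongUSP row) :
    (s : ℝ) ≤ (3 / (2 : ℝ) ^ ((2 + 3 * (bccgnsuDelta / Real.log 3)) / 3)) ^ k := by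
  refine h.card_le_pow.trans (pow_le_pow_left₀ (by positivity) ?_ k)
  have hexp : (2 + 3 * (bccgnsuDelta / Real.log 3)) / 3 ≤ (2 + 3 * foxLovaszExponent 3) / 3 := by
    have := bccgnsuDelta_div_log_le_foxLovaszExponent (p := 3) (by norm_num)
    linarith
  exact div_le_div_of_nonneg_left (by norm_num) (Real.rpow_pos_of_pos two_pos _)
    (Real.rpow_le_rpow_of_exponent_le (by norm_num) hexp)

/-! ## The strong USP capacity is at most `3/2^{(2+3c₃)/3}`; Conjecture 3.4 is false -/

/-- **The strong USP capacity is at most `3/2^{(2+3c₃)/3} ≈ 1.791`** (CKSU's definition, p. 5: "the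
largest constant `C` such that there exist strong USPs of size `(C−o(1))^k` and width `k` for
infinitely many values of `k`", in the tree's `∀ C` unfolding): for every `C > 3/2^{(2+3c₃)/3}`
there is `K` such that every strong USP of every width `k ≥ K` has fewer than `C^k` rows. Proof:
otherwise CKSU Prop. 6.3 (`exists_isLocalStrongUSP_card_ge_pow_of_strongUSP`: blow-ups of size
`|U|!` and width `|U|k`) gives LOCAL strong USPs of size `≥ C'^k`, `3/2^{(2+3c₃)/3} < C' < C`, for
arbitrarily large `k`, contradicting `IsLocalStrongUSP.card_le_pow`.
[cite: BlasiakChurchCohnGrochowNaslundSawinUmans2017, §1 (p. 3) and §3 (p. 6)] [cite: CohnKleinbergSzegedyUmans2005, Prop. 34 (p. 10) and §3 (p. 5, definition of capacity)] -/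
theorem IsStrongUSP.eventually_card_lt_pow_of_lt {C : ℝ}
    (hC : 3 / (2 : ℝ) ^ ((2 + 3 * foxLovaszExponent 3) / 3) < C) :
    ∃ K : ℕ, ∀ k ≥ K, ∀ {s : ℕ} {row : Fin s → Fin k → Fin 3},
      IsStrongUSP row → (s : ℝ) < C ^ k := by
  set B : ℝ := 3 / (2 : ℝ) ^ ((2 + 3 * foxLovaszExponent 3) / 3) with hBdef
  have hB0 : 0 ≤ B := by positivity
  by_contra hcon
  push Not at hcon
  set C' : ℝ := (B + C) / 2 with hC'
  have hC'0 : 0 ≤ C' := by rw [hC']; linarith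
  have hC'C : C' < C := by rw [hC']; linarith
  have hBC' : B < C' := by rw [hC']; linarith
  have hsup : ∀ K : ℕ, ∃ k ≥ K, ∃ s : ℕ, ∃ row : Fin s → Fin k → Fin 3,
      IsStrongUSP row ∧ C ^ k ≤ (s : ℝ) := by
    intro K
    obtain ⟨k, hk, s, row, hrow, hle⟩ := hcon K
    exact ⟨k, hk, s, row, hrow, hle⟩
  obtain ⟨k, hk, s, row, hloc, hle⟩ :=
    exists_isLocalStrongUSP_card_ge_pow_of_strongUSP hsup hC'0 hC'C 1
  have hs : (s : ℝ) ≤ B ^ k := hloc.card_le_pow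
  have hk0 : k ≠ 0 := by omega
  have hlt : B ^ k < C' ^ k := pow_lt_pow_left₀ hBC' hB0 hk0
  linarith

/-- **The strong USP capacity is strictly less than `3/2^{2/3}`**: there is `C < 3/2^{2/3}` and a
width `K` beyond which no strong USP of width `k` has `C^k` rows (any `C` strictly between
`3/2^{(2+3c₃)/3} ≈ 1.791` and `3/2^{2/3} ≈ 1.890` will do, since `c₃ > 0`). Anderson–Le 2023:
"subsequent work has shown that the SUSP capacity is strictly less than `C_max`".
[cite: BlasiakChurchCohnGrochowNaslundSawinUmans2017, §1 (p. 3, "Theorem A disproves the strong USP conjecture")] [cite: AndersonLe2023, §2 (p. 5)] -/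
theorem strongUSPCapacity_lt :
    ∃ C : ℝ, C < 3 / (2 : ℝ) ^ (2 / 3 : ℝ) ∧
      ∃ K : ℕ, ∀ k ≥ K, ∀ {s : ℕ} {row : Fin s → Fin k → Fin 3},
        IsStrongUSP row → (s : ℝ) < C ^ k := by
  set B : ℝ := 3 / (2 : ℝ) ^ ((2 + 3 * foxLovaszExponent 3) / 3) with hBdef
  have hBlt : B < 3 / (2 : ℝ) ^ (2 / 3 : ℝ) := by
    have he : (2 / 3 : ℝ) < (2 + 3 * foxLovaszExponent 3) / 3 := by
      have := foxLovaszExponent_pos (p := 3) (by norm_num)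
      linarith
    have h2 : (2 : ℝ) ^ (2 / 3 : ℝ) < (2 : ℝ) ^ ((2 + 3 * foxLovaszExponent 3) / 3) :=
      Real.rpow_lt_rpow_of_exponent_lt (by norm_num) he
    exact div_lt_div_of_pos_left (by norm_num) (by positivity) h2
  refine ⟨(B + 3 / (2 : ℝ) ^ (2 / 3 : ℝ)) / 2, by linarith, ?_⟩
  exact IsStrongUSP.eventually_card_lt_pow_of_lt (by linarith)

/-- **CKSU 2005, Conjecture 3.4 (= arXiv Conj. 14: "The strong USP capacity equals `3/2^{2/3}`") is
FALSE** — in the tree's unfolding of the capacity (as `exists_isStrongUSP_card_ge_pow`,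
`IsStrongUSP.eventually_card_lt_pow`): it is NOT the case that for every `C < 3/2^{2/3}` there are
strong USPs of width `k` with at least `C^k` rows for infinitely many `k`. ("Theorem A disproves
the strong USP conjecture via [ASU]"; "Theorem B disproves the strong USP conjecture".) The
conjecture "would imply that `ω=2`" (CKSU Cor. 3.6 at `m = 3`); that road is closed.
[cite: BlasiakChurchCohnGrochowNaslundSawinUmans2017, §1 (p. 3) and §3 (p. 6)] [cite: CohnKleinbergSzegedyUmans2005, Conjecture 14 (p. 6)] [cite: AlonShpilkaUmans2013, §1] -/
theorem CKSU2005_strongUSPConjecture_false :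
    ¬ (∀ C : ℝ, C < 3 / (2 : ℝ) ^ (2 / 3 : ℝ) → ∀ K : ℕ, ∃ k ≥ K, ∃ s : ℕ,
        ∃ row : Fin s → Fin k → Fin 3, IsStrongUSP row ∧ C ^ k ≤ (s : ℝ)) := by
  intro hconj
  obtain ⟨C, hC, K, hK⟩ := strongUSPCapacity_lt
  obtain ⟨k, hk, s, row, hrow, hle⟩ := hconj C hC K
  exact absurd hle (not_le.2 (hK k hk hrow))

end Literature.Computability.AlgebraicComplexity

end
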